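import Summits.ResolutionOfSingularities.ResolutionOfSingularities.Theorems.FrobeniusClosingPatchingRelPerfectMonomialRungTargets
import Summits.ResolutionOfSingularities.ResolutionOfSingularities.Theorems.FrobeniusClosingPatchingRelPerfectCoreRungSquarePlusLinearCharts
import Summits.ResolutionOfSingularities.ResolutionOfSingularities.Theorems.FrobeniusClosingPatchingRelPerfectDepthOneExceptionalFormat
import Literature.AlgebraicGeometry.Resolution.MonomialMarkedIdealsBlowup
import Literature.AlgebraicGeometry.Resolution.StrictNormalCrossingsLabels
import Literature.AlgebraicGeometry.Resolution.RsopLocalization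
import Literature.AlgebraicGeometry.Resolution.NormalCrossingsStrictification
import Literature.AlgebraicGeometry.Resolution.KollarFunctorLinearCentre
import Literature.AlgebraicGeometry.Resolution.BlowupsScaling
import HarnessLib

/-!
# Crux `PatchingRelPerfect` (stmt-ResolutionOfSingularities-16161), chain w52 — monomial rung
# «R-mono», target M1 `DepthTargets.MonomialFormat` CLOSED BY NAME

[OURS · L1 W5.2 · R-mono (M1)] Plan-1's typed target `MonomialFormat` of
`…MonomialRungTargets.lean` (CHAIN v1.6, TargetsF3): for a regular local `S` with regular system
of parameters `x₁, …, xₙ` (`n = dim S`) and an `𝔪`-primary monomial ideal `I = (x^α : α ∈ A)`,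
the blow-up `g : X = Bl_𝔪 Spec S → Spec S` is regular and Noetherian, the strict transforms
`D̂₁, …, D̂ₙ` of the coordinate hyperplanes together with the exceptional divisor `ℰ = 𝔪𝒪_X`
form a simple normal crossings system `Es`, and `I𝒪_X` is the SUM OF MONOMIALS
`Σ_{α ∈ A} ℰ^{|α|} · Π_j D̂_j^{α_j}` in that system, cosupported over the closed point.

Route (all pieces are tree tools): the coordinate hyperplanes `V(x₁), …, V(xₙ)` have simple normal
crossings on `Spec S` (`hasSNC_coordinateHyperplanes`: at a prime `𝔭` the `x_j ∈ 𝔭` are part of a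
regular system of parameters of `S_𝔭`, `IsRsopPart.map_of_le_prime` + `hasSNC_of_isRsopPart_labels`);
their common stratum is the closed point, so Kollár's monomial transform
(`comap_monomialIdeal`, `hasSNC_boundaryOf_transformExp` of `Resolution/MonomialMarkedIdealsBlowup.lean`)
gives `x^α 𝒪_X = Π_j D̂_j^{α_j} · ℰ^{|α|} = monomialIdeal (transformExp E_α g T 0)` and the snc
of the transformed boundary; summing over `α ∈ A` gives the format with `e = 0`, and the cosupport
of `I𝒪_X` is `g⁻¹(V(I)) ⊆ g⁻¹{𝔪}`.  PROVED:

* `DepthTargets.monomialFormat_holds : DepthTargets.MonomialFormat` — **M1 by name**;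
* `hasSNC_coordinateHyperplanes`, `idealSheaf_span_prod_pow_eq_monomialIdeal`, `comap_monomialIdeal_eq_transformExp`
  and small list/ideal-sheaf bookkeeping.

Fact-free; nothing here is a statement of the manuscript under review.

## References

* J. Kollár, *Lectures on Resolution of Singularities* (2007), (3.111) Step 3, Def. 3.25. [Kollar2007]
* Q. Liu, *Algebraic Geometry and Arithmetic Curves*, OUP 2002, Thm. 8.1.19 (a). [Liu2002]
* H. Matsumura, *Commutative Ring Theory*, CUP 1986, Thm. 14.2. [Matsumura1987]
-/

-- `Summit.<Summit>.<Sub>.Theorems` with `Sub = Summit` (single-conjunct summit, D-0017)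
set_option linter.dupNamespace false

noncomputable section

open CategoryTheory AlgebraicGeometry Literature.AlgebraicGeometry.Resolution
open IsLocalRing TopologicalSpace

namespace Summit.ResolutionOfSingularities.ResolutionOfSingularities.Theorems

namespace DepthTargets

universe u

/-! ## Ideal sheaves on `Spec S`: sums and monomials -/

section Affine

variable {S : Type u} [CommRing S]

/-- `(I ⊔ J)~ = Ĩ ⊔ J̃` on `Spec S`. [folklore] -/
theorem idealSheaf_sup_eq (I J : Ideal S) :
    affineBlowup.idealSheaf (I ⊔ J) = affineBlowup.idealSheaf I ⊔ affineBlowup.idealSheaf J := by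
  change Scheme.IdealSheafData.equivOfIsAffine.symm _ =
    Scheme.IdealSheafData.equivOfIsAffine.symm _ ⊔ Scheme.IdealSheafData.equivOfIsAffine.symm _
  rw [Ideal.map_sup, map_sup]

/-- `⊥~ = ⊥` on `Spec S`. [folklore] -/
theorem idealSheaf_bot_eq : affineBlowup.idealSheaf (⊥ : Ideal S) = ⊥ := by
  change Scheme.IdealSheafData.equivOfIsAffine.symm _ = ⊥
  rw [Ideal.map_bot, map_bot]

/-- **The stalk of `Ĩ` at a prime `𝔭` is `I · S_𝔭`** (structure-sheaf algebra on the stalk).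
[cite: Hartshorne1977, II Prop. 5.1 (b)] -/
theorem stalkIdeal_idealSheaf_eq (I : Ideal S) (p : Spec (.of S)) :
    letI : Algebra S ((Spec (.of S)).presheaf.stalk p) :=
      inferInstanceAs (Algebra S ((Spec.structureSheaf S).presheaf.stalk p))
    stalkIdeal (affineBlowup.idealSheaf I) p = I.map (algebraMap S ((Spec (.of S)).presheaf.stalk p)) := by
  letI : Algebra S ((Spec (.of S)).presheaf.stalk p) :=
    inferInstanceAs (Algebra S ((Spec.structureSheaf S).presheaf.stalk p))
  rw [stalkIdeal_eq_map_germ (affineBlowup.idealSheaf I) ⟨⊤, isAffineOpen_top _⟩ trivial,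
    affineBlowup.idealSheaf_ideal_top, Ideal.map_map]
  rfl

/-- The span of the image of a list is the iterated sum of the principal ideals. [folklore] -/
theorem span_image_setOf_mem_eq_foldr {ι : Type*} (f : ι → S) (L : List ι) :
    Ideal.span (f '' {a | a ∈ L}) = (L.map fun a => Ideal.span {f a}).foldr (· ⊔ ·) ⊥ := by
  induction L with
  | nil => simp
  | cons a L ih =>
    have hset : {b | b ∈ a :: L} = insert a {b | b ∈ L} := by
      ext b; simp
    rw [hset, Set.image_insert_eq, Ideal.span_insert, ih, List.map_cons, List.foldr_cons]

/-- `Ĩ` of an iterated sum is the iterated sum of the `Ĩ`s. [folklore] -/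
theorem idealSheaf_foldr_sup {ι : Type*} (F : ι → Ideal S) (L : List ι) :
    affineBlowup.idealSheaf ((L.map F).foldr (· ⊔ ·) ⊥) =
      (L.map fun a => affineBlowup.idealSheaf (F a)).foldr (· ⊔ ·) ⊥ := by
  induction L with
  | nil => rw [List.map_nil, List.foldr_nil, List.map_nil, List.foldr_nil, idealSheaf_bot_eq]
  | cons a L ih =>
    rw [List.map_cons, List.foldr_cons, List.map_cons, List.foldr_cons, idealSheaf_sup_eq, ih]

/-- **`(x^α)~` is the monomial ideal of the exponent list `((x_j)~, α_j)_j`.** [folklore] -/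
theorem idealSheaf_span_prod_pow_eq_monomialIdeal : ∀ (n : ℕ) (x : Fin n → S) (α : Fin n → ℕ),
    affineBlowup.idealSheaf (Ideal.span {∏ j, x j ^ α j}) =
      monomialIdeal (List.ofFn fun j => (affineBlowup.idealSheaf (Ideal.span {x j}), α j))
  | 0, x, α => by
    rw [Fin.prod_univ_zero, Ideal.span_singleton_one, affineBlowup.idealSheaf_top, List.ofFn_zero,
      monomialIdeal_nil]
  | n + 1, x, α => by
    rw [Fin.prod_univ_succ, ← Ideal.span_singleton_mul_span_singleton, affineBlowup.idealSheaf_mul,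
      ← Ideal.span_singleton_pow, DepthOne.idealSheaf_pow, List.ofFn_succ, monomialIdeal_cons,
      idealSheaf_span_prod_pow_eq_monomialIdeal n (fun j => x j.succ) (fun j => α j.succ)]

end Affine

/-! ## Pull-backs of iterated sums and the monomial transform at exponent `0` -/

section Pullback

variable {X X' : Scheme.{u}}

/-- `comap` of an iterated sum is the iterated sum of the `comap`s. [folklore] -/
theorem comap_foldr_sup {ι : Type*} (F : ι → X.IdealSheafData) (L : List ι) (π : X' ⟶ X) :
    ((L.map F).foldr (· ⊔ ·) ⊥).comap π = (L.map fun a => (F a).comap π).foldr (· ⊔ ·) ⊥ := by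
  induction L with
  | nil => simp
  | cons a L ih =>
    rw [List.map_cons, List.foldr_cons, List.map_cons, List.foldr_cons,
      Scheme.IdealSheafData.comap_sup, ih]

/-- `monomialSum` of a mapped list, unfolded. [folklore] -/
theorem monomialSum_map {ι : Type*} (K : ι → List (X.IdealSheafData × ℕ)) (L : List ι) :
    monomialSum (L.map K) = (L.map fun a => monomialIdeal (K a)).foldr (· ⊔ ·) ⊥ := by
  rw [monomialSum, List.map_map]
  rfl

/-- **The monomial transform at control exponent `0`** (Kollár (3.111) Step 3): along the blowing up
`π` of the stratum of `T`, `(Π_j 𝓘_j^{a_j})𝒪 = monomialIdeal (transformExp E π T 0)` — the strict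
transforms with the old exponents and the exceptional divisor with exponent `Σ_T a_j`.
[cite: Kollar2007, (3.111) Step 3] -/
theorem comap_monomialIdeal_eq_transformExp [IsLocallyNoetherian X] {π : X' ⟶ X}
    {E : List (X.IdealSheafData × ℕ)} {T : Finset X.IdealSheafData} (hE : HasSNC (boundaryOf E))
    (hT : ∀ K ∈ T, K ∈ boundaryOf E) (hπ : IsBlowup π (T.sup id)) :
    (monomialIdeal E).comap π = monomialIdeal (transformExp E π T 0) := by
  rw [comap_monomialIdeal hE hT hπ, transformExp, monomialIdeal_append, monomialIdeal_singleton,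
    Nat.sub_zero, mul_comm]

end Pullback

/-! ## Simple normal crossings of the coordinate hyperplanes of a regular local ring -/

section Coordinates

variable {S : Type u} [CommRing S] [IsRegularLocalRing S] {n : ℕ} (x : Fin n → S)
  (hx : Ideal.span (Set.range x) = maximalIdeal S) (hn : (maximalIdeal S).spanFinrank = n)

omit [IsRegularLocalRing S] in
/-- Membership in the support of `(a)~`: the prime contains `a`. [folklore] -/
theorem mem_support_idealSheaf_span_singleton_iff (a : S) (p : Spec (.of S)) :
    p ∈ (affineBlowup.idealSheaf (Ideal.span {a})).support ↔ a ∈ p.asIdeal := by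
  change p ∈ ((affineBlowup.idealSheaf (Ideal.span {a})).support : Set (Spec (.of S))) ↔ _
  rw [affineBlowup.support_idealSheaf]
  change ((Ideal.span {a} : Ideal S) : Set S) ⊆ p.asIdeal ↔ _
  rw [SetLike.coe_subset_coe, Ideal.span_singleton_le_iff_mem]

include hx hn in
/-- **The coordinate hyperplanes `V(x₁), …, V(xₙ)` of a regular local ring have simple normal
crossings on `Spec S`**: at a prime `𝔭`, the `x_j ∈ 𝔭` are part of a regular system of parameters
of `S_𝔭 = 𝒪_{Spec S, 𝔭}` (`IsRsopPart.map_of_le_prime`, Matsumura 14.2 + Serre), and they generate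
the stalks of the `(x_j)~` through `𝔭`. [cite: Matsumura1987, Thm. 14.2] -/
theorem hasSNC_coordinateHyperplanes :
    HasSNC (List.ofFn fun j => affineBlowup.idealSheaf (Ideal.span {x j})) := by
  classical
  refine hasSNC_of_isRsopPart_labels _ fun p => ?_
  letI : Algebra S ((Spec (.of S)).presheaf.stalk p) :=
    inferInstanceAs (Algebra S ((Spec.structureSheaf S).presheaf.stalk p))
  haveI : IsLocalization.AtPrime ((Spec (.of S)).presheaf.stalk p) p.asIdeal :=
    inferInstanceAs (IsLocalization.AtPrime ((Spec.structureSheaf S).presheaf.stalk p) p.asIdeal)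
  -- the indices of the hyperplanes through `p`
  set J : Finset (Fin n) := Finset.univ.filter fun j => x j ∈ p.asIdeal with hJ
  let e : Fin J.card ≃ J := J.equivFin.symm
  let ι₀ : Fin J.card → Fin n := fun i => (e i).1
  have hι₀ : Function.Injective ι₀ := fun i i' h => e.injective (Subtype.ext h)
  have hmem : ∀ i, (x ∘ ι₀) i ∈ p.asIdeal := fun i => (Finset.mem_filter.mp (e i).2).2
  have hz : IsRsopPart fun i => algebraMap S ((Spec (.of S)).presheaf.stalk p) ((x ∘ ι₀) i) :=
    (isRsopPart_comp_of_rsop hn x hx ι₀ hι₀).map_of_le_prime p.asIdeal hmem _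
  refine ⟨J.card, _, hz, ?_⟩
  -- label a hyperplane through `p` by its index
  have hidx : ∀ D : {D : (Spec (.of S)).IdealSheafData //
      D ∈ (List.ofFn fun j => affineBlowup.idealSheaf (Ideal.span {x j})) ∧ p ∈ D.support},
      ∃ j : Fin n, affineBlowup.idealSheaf (Ideal.span {x j}) = D.1 ∧ x j ∈ p.asIdeal := by
    rintro ⟨D, hD, hpD⟩
    obtain ⟨j, rfl⟩ := (List.mem_ofFn' _ _).mp hD
    exact ⟨j, rfl, (mem_support_idealSheaf_span_singleton_iff (x j) p).mp hpD⟩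
  choose idx hidx₁ hidx₂ using hidx
  refine ⟨fun D => e.symm ⟨idx D, Finset.mem_filter.mpr ⟨Finset.mem_univ _, hidx₂ D⟩⟩, ?_, ?_⟩
  · intro D D' h
    have h' : idx D = idx D' := congrArg Subtype.val (e.symm.injective h)
    apply Subtype.ext
    rw [← hidx₁ D, ← hidx₁ D', h']
  · intro D
    have hval : ι₀ (e.symm ⟨idx D, Finset.mem_filter.mpr ⟨Finset.mem_univ _, hidx₂ D⟩⟩) = idx D := by
      simp only [ι₀, Equiv.apply_symm_apply]
    rw [← hidx₁ D, stalkIdeal_idealSheaf_eq, Ideal.map_span, Set.image_singleton, Function.comp_apply, hval]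
    rfl

include hx in
/-- The stratum of all the coordinate hyperplanes is the closed point: `⊔_j (x_j)~ = 𝔪~`. [folklore] -/
theorem finsetSup_idealSheaf_span_singleton (T : Finset (Spec (.of S)).IdealSheafData)
    (hT : ∀ K, K ∈ T ↔ ∃ j, affineBlowup.idealSheaf (Ideal.span {x j}) = K) :
    T.sup id = affineBlowup.idealSheaf (maximalIdeal S) := by
  rw [← hx]
  apply le_antisymm
  · refine Finset.sup_le fun K hK => ?_
    obtain ⟨j, rfl⟩ := (hT K).mp hK
    change affineBlowup.idealSheaf _ ≤ affineBlowup.idealSheaf _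
    rw [affineBlowup.idealSheaf_le_idealSheaf_iff, Ideal.span_singleton_le_iff_mem]
    exact Ideal.subset_span ⟨j, rfl⟩
  · have hM : Ideal.span (Set.range x) = ⨆ j, Ideal.span {x j} := by
      rw [← Set.iUnion_singleton_eq_range, Ideal.span_iUnion]
    have htil : affineBlowup.idealSheaf (⨆ j, Ideal.span {x j}) =
        ⨆ j, affineBlowup.idealSheaf (Ideal.span {x j}) := by
      change Scheme.IdealSheafData.ofIdealTop _ = ⨆ j, Scheme.IdealSheafData.ofIdealTop _
      rw [Ideal.map_iSup]
      exact (Scheme.IdealSheafData.equivOfIsAffine (X := Spec (.of S))).symm.toOrderIso.map_iSup _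
    rw [hM, htil]
    exact iSup_le fun j => Finset.le_sup (f := id) ((hT _).mpr ⟨j, rfl⟩)

end Coordinates

/-! ## M1 by name -/

/-- **M1 `MonomialFormat` CLOSED BY NAME** (plan-1 TargetsF3, CHAIN v1.6): on `X = Bl_𝔪 Spec S`
(regular, Noetherian) the strict transforms of the coordinate hyperplanes and the exceptional divisor
`ℰ` have simple normal crossings, `ℰ` is locally principal, and the `𝔪`-primary monomial ideal
`I = (x^α : α ∈ A)` pulls back to the sum of monomials `Σ_α Π_j D̂_j^{α_j} · ℰ^{|α|}`
(`e = 0`), cosupported over the closed point. [cite: Kollar2007, (3.111) Step 3]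
[cite: Liu2002, Thm. 8.1.19 (a)] -/
theorem monomialFormat_holds : MonomialFormat.{u} := by
  classical
  intro S _ _ n x hx hn A hA N hN
  haveI : IsRegularRing S := isRegularRing_of_isRegularLocalRing S
  haveI : IsDomain S := isDomain_of_isRegularLocalRing S
  -- `x` is a regular system of parameters
  have hd : (maximalIdeal S).spanFinrank = n := by
    have h := IsRegularLocalRing.spanFinrank_maximalIdeal (R := S)
    rw [← hn] at h
    exact_mod_cast h
  have hrsop : IsRsopPart x := by
    have h := isRsopPart_comp_of_rsop hd x hx id Function.injective_id
    simpa using h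
  -- `I ≠ ⊥`
  obtain ⟨α₀, hα₀⟩ := hA
  have hI : monomialSpan x A ≠ ⊥ := by
    intro h
    have hmem : ∏ j, x j ^ α₀ j ∈ monomialSpan x A := Ideal.subset_span ⟨α₀, hα₀, rfl⟩
    rw [h, Ideal.mem_bot] at hmem
    exact (Finset.prod_ne_zero_iff.mpr fun j _ => pow_ne_zero _ (hrsop.ne_zero j)) hmem
  refine ⟨hI, ?_⟩
  -- `I` as an iterated sum over the list of exponents
  have hspan : monomialSpan x A =
      (A.toList.map fun α => Ideal.span {∏ j, x j ^ α j}).foldr (· ⊔ ·) ⊥ := by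
    rw [← span_image_setOf_mem_eq_foldr]
    unfold monomialSpan
    congr 1
    ext b
    simp
  -- the coordinate hyperplanes downstairs and their stratum `T`
  set E₀ : Fin n → (Spec (.of S)).IdealSheafData :=
    fun j => affineBlowup.idealSheaf (Ideal.span {x j}) with hE₀
  set T : Finset (Spec (.of S)).IdealSheafData := Finset.univ.image E₀ with hT
  set Eα : (Fin n → ℕ) → List ((Spec (.of S)).IdealSheafData × ℕ) :=
    fun α => List.ofFn fun j => (E₀ j, α j) with hEα
  have hbd : ∀ α, boundaryOf (Eα α) = List.ofFn E₀ := by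
    intro α
    simp [hEα, boundaryOf, List.map_ofFn, Function.comp_def]
  have hsnc₀ : HasSNC (List.ofFn E₀) := hasSNC_coordinateHyperplanes x hx hd
  have hTmem : ∀ K ∈ T, K ∈ List.ofFn E₀ := by
    intro K hK
    obtain ⟨j, -, rfl⟩ := Finset.mem_image.mp hK
    exact (List.mem_ofFn' _ _).mpr ⟨j, rfl⟩
  have hTsup : T.sup id = affineBlowup.idealSheaf (maximalIdeal S) :=
    finsetSup_idealSheaf_span_singleton x hx T fun K => by
      rw [hT, Finset.mem_image]
      exact ⟨fun ⟨j, _, h⟩ => ⟨j, h⟩, fun ⟨j, h⟩ => ⟨j, Finset.mem_univ _, h⟩⟩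
  -- the blow-up of the closed point
  set M : Ideal S := Ideal.span (Set.range x) with hMdef
  haveI : M.IsMaximal := hx ▸ IsLocalRing.maximalIdeal.isMaximal S
  haveI : IsRegularRing (S ⧸ M) := by letI := Ideal.Quotient.field M; infer_instance
  have hg : IsBlowup (affineBlowup.π M) (affineBlowup.idealSheaf (maximalIdeal S)) := by
    rw [← hx]; exact affineBlowup.isBlowup M
  have hgT : IsBlowup (affineBlowup.π M) (T.sup id) := by rw [hTsup]; exact hg
  have hXreg : Scheme.IsRegular (affineBlowup M) :=
    isRegular_of_isBlowup_idealSheaf_of_quotient M (affineBlowup.isBlowup M)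
  have hXnoeth : IsNoetherian (affineBlowup M) := isNoetherian_of_isBlowup (affineBlowup.isBlowup M)
  -- the data upstairs
  refine ⟨affineBlowup M, affineBlowup.π M, boundaryOf (transformExp (Eα α₀) (affineBlowup.π M) T 0),
    (T.sup id).comap (affineBlowup.π M), A.toList.map fun α => transformExp (Eα α) (affineBlowup.π M) T 0,
    0, hg, hXreg, hXnoeth, ?_, ?_, ?_, ?_, ?_, ?_, ?_⟩
  · -- snc of the transformed boundary
    exact hasSNC_boundaryOf_transformExp ((hbd α₀).symm ▸ hsnc₀) (fun K hK => (hbd α₀).symm ▸ hTmem K hK)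
      hgT 0
  · -- `ℰ ∈ Es`
    rw [boundaryOf_transformExp]
    exact List.mem_append_right _ (List.mem_singleton_self _)
  · -- `ℰ` is locally principal
    exact hgT.isEffectiveCartier.isLocallyPrincipal
  · -- every exponent list lives on `Es`
    intro K hK
    obtain ⟨α, -, rfl⟩ := List.mem_map.mp hK
    rw [boundaryOf_transformExp, boundaryOf_transformExp, hbd, hbd]
  · -- the family is non-empty
    intro h
    rw [List.map_eq_nil_iff, Finset.toList_eq_nil] at h
    rw [h] at hα₀
    exact Finset.notMem_empty _ hα₀
  · -- cosupport over the closed point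
    intro y hy
    have hfmt : monomialSum (A.toList.map fun α => transformExp (Eα α) (affineBlowup.π M) T 0) =
        (affineBlowup.idealSheaf (monomialSpan x A)).comap (affineBlowup.π M) := by
      rw [monomialSum_map, hspan, idealSheaf_foldr_sup, comap_foldr_sup]
      congr 1
      refine List.map_congr_left fun α _ => ?_
      rw [idealSheaf_span_prod_pow_eq_monomialIdeal,
        comap_monomialIdeal_eq_transformExp ((hbd α).symm ▸ hsnc₀)
          (fun K hK => (hbd α).symm ▸ hTmem K hK) hgT]
    rw [hfmt] at hy
    have hy' : y ∈ (((affineBlowup.idealSheaf (monomialSpan x A)).comap (affineBlowup.π M)).support :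
        Set (affineBlowup M)) := hy
    rw [Scheme.IdealSheafData.support_comap] at hy'
    exact support_idealSheaf_subset_closedPoint (Q := monomialSpan x A) (n := N) hN _ hy'
  · -- the format with `e = 0`
    rw [pow_zero, one_mul, monomialSum_map, hspan, idealSheaf_foldr_sup, comap_foldr_sup]
    congr 1
    refine List.map_congr_left fun α _ => ?_
    rw [idealSheaf_span_prod_pow_eq_monomialIdeal,
      comap_monomialIdeal_eq_transformExp ((hbd α).symm ▸ hsnc₀)
        (fun K hK => (hbd α).symm ▸ hTmem K hK) hgT]

end DepthTargets

end Summit.ResolutionOfSingularities.ResolutionOfSingularities.Theorems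

end
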